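import Summits.Langlands.Langlands.Theses.SmithKummerSeed
import Summits.Langlands.Langlands.Theorems.IrreducibilityBySelfDualityReciprocityUpToIrreducibilityCorrespondsConj
import Summits.Langlands.Langlands.Theorems.IrreducibilityBySelfDualityIrreducibleOffSectorBaseChange
import Literature.NumberTheory.Automorphic.TunnellOctahedralGlobal
import Literature.NumberTheory.GaloisRepresentations.CliffordTwistOfRestriction
import Literature.NumberTheory.GaloisRepresentations.ToLocalRestrictField

/-!
# The ATOM of `AscentConjugationSolvable` (stmt-Langlands-1094), typed R-free at Satake level — lead c2, 2026-08-17

Crux workfile (`Cruxes/AscentConjugationSolvable/Atom.lean`; elaborates, no `sorry`).  Audience: the planner who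
re-lines stmt-Langlands-18645 `CyclicPrimeDescent` (recommendation R1 of `ANALYSIS-c1.md`), crux ideation, the
disprover.  The crux is 18649 ∧ 18645 (glue p151345; finer: the four strategist stubs, glue p161600 +
`SmithKummerSeedCyclicPrimeAscentOfStubs`); the only piece that is OPEN MATHEMATICS (as opposed to infrastructure:
`ReciprocityData` non-constructibility = stmt-17930, transport of `LocalGlobalCompatibleAt` = stmt-18101 + a local
base-change predicate) is the (A)-half of the DOWN-step at the INERT places.  This file states that residue as ONE
`Prop` over the tree's vocabulary, free of reciprocity data and of local–global compatibility, and proves that it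
is implied by weak direction (A) over the lower field (so it is summit-implied and correctly oriented: a refuter
can only run `_false_without_H` probes against it).

## The statement `InertTwistCoherenceAE`

Setting: `L/K` Galois of prime degree `p`; `π` cuspidal L-algebraic on `GL_n(𝔸_K)`; `Π` automorphic on
`GL_n(𝔸_L)`, a weak base-change lift of `π` (`IsWeakBaseChangeLiftAE`: at a.e. `w ∣ v`, `Sat(Π_w) = Sat(π_v)^{f(w|v)}`
— Arthur–Clozel Ch. 3 Thm. 4.2 gives such `Π`, tree fact `exists_baseChange_cyclic`); `ρ₀ : Γ_K → GL_n(ℚ̄_ℓ)` a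
framed representation whose restriction to `Γ_L` is IRREDUCIBLE and Satake–Frobenius compatible with `Π` at a.e.
place of `L` (such `ρ₀` exist whenever `Π` is cuspidal with irreducible `ρ_Π`: `ρ_Π` is `Gal(L/K)`-stable since
`Π` is, and extends along the cyclic layer — landed `exists_restrictField_eq_of_frobStable`, p156869; the candidates
are then exactly the twists `ρ₀ ⊗ η^j`, `η` a character of `Gal(L/K)` — landed `exists_twist_of_conj_restrictField`,
p152528).  CLAIM: some twist `ρ₀ ⊗ χ`, `χ` trivial on `Γ_L`, is Satake–Frobenius compatible with `π` itself at
a.e. place of `K`.  At places `v` SPLIT in `L/K` this is automatic for every `j` (`f = 1`, `Frob_w = Frob_v`); at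
INERT `v` (`f = p`) the hypothesis pins only `{β_i^p} = {α_i^p}` (`β` = eigenvalues of `ρ₀(Frob_v)`, `α = Sat(π_v)`)
and the claim asks for ONE GLOBAL `j` with `{α_i} = ζ^j {β_i}` at every inert `v` — the root-of-unity coherence of
`ANALYSIS-c1.md` §1.  Known: `n = 1` (= Artin reciprocity over `K`), `n = 2` with `K/F₁` non-normal cubic
(Jacquet–Piatetski-Shapiro–Shalika 1981, tree fact `JPSS1981_exists_weakBaseChangeLift_cubic`, + Tunnell's unique
index for octahedral Artin `ρ`); open otherwise (Arthur–Clozel Ch. 3 §7 closing remark; Lapid–Rogawski 1998;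
Rajan 2002).

## What is proved here (sorry-free)

* `inertTwistCoherenceFor_of_weakAutToGal` — weak (A) over `K` for `π` (some `ρ_π` a.e. compatible with `π`)
  implies the claim for `π`: `ρ_π|_{Γ_L}` is a.e. compatible with `Π` (landed
  `IrreducibleOffSector.eventually_satakeFrobCompatibleAt_restrictField`), two avatars of `Π` with one irreducible
  are conjugate (landed `ReciprocityUpToIrreducibility.isConjugate_of_satakeFrobCompatibleAt`: Chebotarev +
  Brauer–Nesbitt), conjugate irreducible restrictions differ by a twist killing `Γ_L` (landed
  `FramedGaloisRep.exists_twist_of_conj_restrictField`), and compatibility is a class function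
  (`satakeFrobCompatibleAt_conj`).  Hence `InertTwistCoherenceAE` is a consequence of the summit, and conversely
  it is exactly what the (A)-descent needs beyond the landed Galois-side toolkit (p152528, p155706, p156137,
  p156869, p157081, p158666, p159169) and the Arthur–Clozel facts: given it, weak (A) over `K` for every `π` with
  CUSPIDAL base change follows from weak (A) over `L`; the non-cuspidal case `π ≅ π ⊗ η` is induced (`ρ_π := Ind`,
  `FramedGaloisRep.induce`, `hasFrobCharpolyAt_induce`) and carries no atom.

## Lead c2 additions to the analysis of `ANALYSIS-c1.md` §2 (dead ends, one line each)

8. `n = 1`: the atom for a Hecke character `χ` of `K` is the existence of `ρ_χ` over `K`, i.e. Artin reciprocity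
   over `K`; historically not obtained by descent from overfields either (Artin: cyclotomic crossing + Chebotarev).
9. Non-normal cubic BASE CHANGE `BC_{K/ℚ}` on `GL_m` (`K = ℚ(∛2)`): `BC_{L/ℚ}(τ)` exists (solvable Galois) and is
   `Gal(L/K)`-stable, so it descends to `K` up to `⊗ η` (cyclic descent) — choosing the descent IS the atom at the
   transposition primes; known `m ≤ 3` (converse theorems with `GL_1` twists), open `m ≥ 4`; so neither
   non-normal AI nor non-normal BC is available as a lever beyond the JPSS range.
10. The real place of `K` (inert in the CM-like layer `L/K`, `η(c) = -1`): the omitted sign law BG 3.2.1(4) would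
    PIN `j` (the two candidates have opposite `ρ(c)`-signatures when `n` is odd), but pins do not prove coherence at
    the finite inert places (ANALYSIS-c1 §1, confirmed).
11. Tunnell 1981 (octahedral Artin): the unique index `i` with `BC_{K/F}(π_i) = π(ρ_K)` is found because BOTH sides
    over `K` are known independently (Langlands' tetrahedral case over `K` + JPSS); no analogue without (A) over `K`.

References: [ArthurClozelAMS120] Ch. 3 Thm. 4.2, §7; [JPSS1981Cubique]; [Tunnell1981];
doi:10.4310/mrl.2002.v9.n4.a9 (Rajan 2002); doi:10.1515/form.10.2.175 (Lapid–Rogawski 1998);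
[DeligneSerreASENS1974] Lemme 3.2; [Clifford1937].
-/

set_option linter.dupNamespace false

noncomputable section

namespace Summit.Langlands.Langlands.Cruxes.AscentConjugationSolvable.Atom

open scoped MatrixGroups NumberField Classical Matrix
open Filter IsDedekindDomain Field
open Literature.NumberTheory.Automorphic Literature.NumberTheory.GaloisRepresentations
open Summit.Langlands

/-- **The atom, for ONE `π` and ONE candidate `ρ₀`** (R-free, Satake level): if `Π/L` is a weak base-change lift
of the cuspidal `π/K` along the Galois prime-degree layer `L/K`, and `ρ₀ : Γ_K → GL_n(ℚ̄_ℓ)` has irreducible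
restriction to `Γ_L` that is Satake–Frobenius compatible with `Π` almost everywhere, then SOME twist of `ρ₀` by a
character trivial on `Γ_L` is Satake–Frobenius compatible with `π` almost everywhere (the twist exponent `j` is
GLOBAL: one `j` serves every inert place). [cite: ArthurClozelAMS120, Ch. 3 Thm. 4.2 and §7] -/
def InertTwistCoherenceFor {K L : Type} [Field K] [NumberField K] [Field L] [NumberField L] [Algebra K L]
    {n : ℕ} {hK : isCompact_glFiniteIntegralLevel n K} {hL : isCompact_glFiniteIntegralLevel n L}
    (π : CuspidalAutomorphicRepData n K hK) (P : AutomorphicRepData (AutomorphyDatum.gl n L hL))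
    {ℓ : ℕ} [Fact ℓ.Prime] (ι : PadicAlgCl ℓ ≃+* ℂ) (ρ₀ : FramedGaloisRep K (PadicAlgCl ℓ) n) : Prop :=
  IsWeakBaseChangeLiftAE π.1 P →
    (ρ₀.restrictField L).toGaloisRep.IsIrreducible →
      (∀ᶠ w : HeightOneSpectrum (𝓞 L) in cofinite, SatakeFrobCompatibleAt ι P (ρ₀.restrictField L) w) →
        ∃ (χ : absoluteGaloisGroup K →ₜ* (PadicAlgCl ℓ)ˣ),
          (∀ σ : absoluteGaloisGroup L, χ (absGaloisRestrict K L σ) = 1) ∧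
            ∀ᶠ v : HeightOneSpectrum (𝓞 K) in cofinite, SatakeFrobCompatibleAt ι π.1 (ρ₀.twist χ) v

/-- **`InertTwistCoherenceAE` — the open residue of `stub_primeDescent` / `stub_descentAutToGal`, all at once**:
for every Galois layer `L/K` of prime degree, every cuspidal L-algebraic `π` of `GL_n(𝔸_K)`, every weak
base-change lift `Π` of `π` to `L`, every `ℓ`, `ι`, and every `ρ₀ : Γ_K → GL_n(ℚ̄_ℓ)` with irreducible restriction
to `Γ_L` a.e. compatible with `Π`, some twist `ρ₀ ⊗ χ` (`χ` trivial on `Γ_L`) is a.e. compatible with `π`.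
Solvable NON-NORMAL base change in Galois clothing; known for `n = 1` and for `n = 2` below a non-normal cubic
(JPSS 1981 + Tunnell), open otherwise.  Implied by weak (A) over `K` (`inertTwistCoherenceAE_of_weakAutToGal`).
[cite: ArthurClozelAMS120, Ch. 3 §7] [cite: JPSS1981Cubique] -/
def InertTwistCoherenceAE : Prop :=
  ∀ (K L : Type) [Field K] [NumberField K] [Field L] [NumberField L] [Algebra K L] [IsGalois K L],
    (Module.finrank K L).Prime →
    ∀ (n : ℕ) (hK : isCompact_glFiniteIntegralLevel n K) (hL : isCompact_glFiniteIntegralLevel n L)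
      (π : CuspidalAutomorphicRepData n K hK), π.1.IsLAlgebraic →
      ∀ (P : AutomorphicRepData (AutomorphyDatum.gl n L hL)) (ℓ : ℕ) [Fact ℓ.Prime]
        (ι : PadicAlgCl ℓ ≃+* ℂ) (ρ₀ : FramedGaloisRep K (PadicAlgCl ℓ) n),
        InertTwistCoherenceFor π P ι ρ₀

/-- **Weak (A) over `K` for `π` implies the atom for `π`.**  If some `ρ : Γ_K → GL_n(ℚ̄_ℓ)` is Satake–Frobenius
compatible with `π` a.e., then for every weak base change `Π` of `π` to a finite extension `L` and every `ρ₀` with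
irreducible restriction a.e. compatible with `Π`, a twist of `ρ₀` by a character trivial on `Γ_L` is a.e.
compatible with `π`: `ρ|_{Γ_L}` is a.e. compatible with `Π` (`eventually_satakeFrobCompatibleAt_restrictField`),
so `ρ₀|_{Γ_L}` and `ρ|_{Γ_L}` are conjugate (`isConjugate_of_satakeFrobCompatibleAt`), so `ρ` is conjugate to a
twist `ρ₀ ⊗ χ` with `χ|_{Γ_L} = 1` (`exists_twist_of_conj_restrictField`), and compatibility passes along the
conjugation (`satakeFrobCompatibleAt_conj`).  `L/K` Galois; no hypothesis on `[L:K]`.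
[cite: DeligneSerreASENS1974, Lemme 3.2] [cite: Clifford1937, Thm. 1] -/
theorem inertTwistCoherenceFor_of_weakAutToGal {K L : Type} [Field K] [NumberField K] [Field L]
    [NumberField L] [Algebra K L] [IsGalois K L] {n : ℕ} {hK : isCompact_glFiniteIntegralLevel n K}
    {hL : isCompact_glFiniteIntegralLevel n L} (π : CuspidalAutomorphicRepData n K hK)
    (P : AutomorphicRepData (AutomorphyDatum.gl n L hL)) {ℓ : ℕ} [Fact ℓ.Prime] (ι : PadicAlgCl ℓ ≃+* ℂ)
    (ρ₀ : FramedGaloisRep K (PadicAlgCl ℓ) n)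
    (hA : ∃ ρ : FramedGaloisRep K (PadicAlgCl ℓ) n,
      ∀ᶠ v : HeightOneSpectrum (𝓞 K) in cofinite, SatakeFrobCompatibleAt ι π.1 ρ v) :
    InertTwistCoherenceFor π P ι ρ₀ := by
  intro hBC hirr h₀
  obtain ⟨ρ, hρ⟩ := hA
  -- `ρ|_{Γ_L}` is a.e. compatible with the weak base change `Π`
  have hρL : ∀ᶠ w : HeightOneSpectrum (𝓞 L) in cofinite,
      SatakeFrobCompatibleAt ι P (ρ.restrictField L) w :=
    Theorems.IrreducibleOffSector.eventually_satakeFrobCompatibleAt_restrictField ι π.1 P hBC ρ hρ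
  -- two avatars of `Π`, the first irreducible: conjugate
  obtain ⟨P, hP⟩ :=
    Theorems.ReciprocityUpToIrreducibility.isConjugate_of_satakeFrobCompatibleAt P ι hirr h₀ hρL
  -- Clifford: `ρ` is conjugate to a twist of `ρ₀` by a character trivial on `Γ_L`
  obtain ⟨χ, Q, hχ, hQ⟩ :=
    FramedGaloisRep.exists_twist_of_conj_restrictField (M := L) ρ ρ₀ hirr
      ⟨P⁻¹, by rw [← hP, FramedRep.conj_inv_conj_eq]⟩
  refine ⟨χ, hχ, ?_⟩
  filter_upwards [hρ] with v hv
  rw [← hQ]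
  exact Theorems.ReciprocityUpToIrreducibility.satakeFrobCompatibleAt_conj ι π.1 Q hv

/-- **`InertTwistCoherenceAE` is summit-implied**: weak direction (A) over every number field (for cuspidal
L-algebraic `π`, some `ρ` a.e. Satake–Frobenius compatible with `π`, for all `ℓ`, `ι`) implies it.  In
particular reciprocity over `K` in the summit's sense implies the atom over `K`, so no refutation short of
`¬ Langlands` exists; the content of the atom is the converse use: it is what (A)-descent along `L/K` needs.
[cite: BuzzardGeeLMS2014, Conj. 3.2.1] -/
theorem inertTwistCoherenceAE_of_weakAutToGal
    (hA : ∀ (K : Type) [Field K] [NumberField K] (n : ℕ) (hK : isCompact_glFiniteIntegralLevel n K)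
      (π : CuspidalAutomorphicRepData n K hK), π.1.IsLAlgebraic →
      ∀ (ℓ : ℕ) [Fact ℓ.Prime] (ι : PadicAlgCl ℓ ≃+* ℂ), ∃ ρ : FramedGaloisRep K (PadicAlgCl ℓ) n,
        ∀ᶠ v : HeightOneSpectrum (𝓞 K) in cofinite, SatakeFrobCompatibleAt ι π.1 ρ v) :
    InertTwistCoherenceAE :=
  fun K _ _ _ _ _ _ _ _ n hK _ π hπ P ℓ _ ι ρ₀ =>
    inertTwistCoherenceFor_of_weakAutToGal π P ι ρ₀ (hA K n hK π hπ ℓ ι)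

/-- **Direction (A) of the summit over `K` (for some reciprocity data) implies the atom over `K`** — the form in
which the skeleton's `stub_primeDescent` hypothesis would feed it if `K` were the UPPER field; recorded to make
the orientation explicit: the atom is about the LOWER field of the layer, where (A) is NOT available.
[cite: BuzzardGeeLMS2014, Conj. 3.2.1] -/
theorem inertTwistCoherenceFor_of_autToGal {K L : Type} [Field K] [NumberField K] [Field L]
    [NumberField L] [Algebra K L] [IsGalois K L] (R : ReciprocityData K) {n : ℕ}
    {hK : isCompact_glFiniteIntegralLevel n K} (hA : AutomorphicToGalois n R hK)
    {hL : isCompact_glFiniteIntegralLevel n L} (π : CuspidalAutomorphicRepData n K hK)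
    (hπ : π.1.IsLAlgebraic) (P : AutomorphicRepData (AutomorphyDatum.gl n L hL)) {ℓ : ℕ} [Fact ℓ.Prime]
    (ι : PadicAlgCl ℓ ≃+* ℂ) (ρ₀ : FramedGaloisRep K (PadicAlgCl ℓ) n) :
    InertTwistCoherenceFor π P ι ρ₀ := by
  obtain ⟨ρ, -, -, hcorr, -⟩ := hA π hπ ℓ ι
  exact inertTwistCoherenceFor_of_weakAutToGal π P ι ρ₀ ⟨ρ, hcorr.1⟩

end Summit.Langlands.Langlands.Cruxes.AscentConjugationSolvable.Atom

end
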